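import Summits.NavierStokesRegularity.NavierStokesRegularity.Theorems.CoriolisHeadLocalEnergyDriftNormalFormClosed
import HarnessLib

/-!
# CoriolisHeadLocalEnergyPressureIdentification — crux `NoCoRotatingCore` (stmt-NavierStokesRegularity-22676), line
# `local_energy_rescue` (crux workfile v2.1, ns-idea-10 g3), stub S3a `stub_localEnergyClass`: first ingredient

`LocalEnergyRescue.pressure_eq_pressurePotentialMod_add_const`: for a bounded smooth rotated profile `(ν, a, B, U, P)` whose pressure
ALREADY has bounded quadratic mean oscillation (`∫_{B(z,ρ)} (P − m)² ≤ K ρ³` on all balls — the hypothesis of S2/S3a of the line),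
`P = Q̃ + c` with `Q̃ = pressurePotentialMod 0 U` the tree's Riesz pressure of the bounded field modulo constants — the
«identification `P = RᵢRⱼ(UᵢUⱼ) + m`» that S3a's card invokes before its Calderón–Zygmund near/far split.  Proof:
`P = Q̃ + ⟪ℓ, ·⟫ + c` (`exists_affine_of_rieszPressure` with the smooth `BMO₂` Riesz pressure of
`contDiff_pressurePotentialMod_of_rotatedProfile` / `exists_sq_oscillation_pressurePotentialMod_le`), and a non-constant affine function is
not `BMO₂`: on one of the two quarter-balls `B(±ρℓ/(2‖ℓ‖), ρ/4) ⊆ B(0,ρ)` the function `⟪ℓ,y⟫ + d` has modulus `≥ ‖ℓ‖ρ/4`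
whatever the sign of `d` (`sq_oscillation_affine_ge`), so `‖ℓ‖² |B₁| ρ⁵ / 1024 ≤ 2(K + K′)ρ³` for all `ρ`, forcing `ℓ = 0`.

HONEST FRAMING.  Helper for an unregistered line; S3a, `NoCoRotatingCore` and NS regularity are NOT proved.

References: G. Seregin, *Lecture Notes on Regularity Theory for the Navier–Stokes Equations* (2014), §6.2 Lemma 6.5, Thm 2.6,
Remarks 6.2–6.4 [Seregin2014]; G. Koch, N. Nadirashvili, G. Seregin, V. Šverák, Acta Math. 203 (2009), §4 [KochNadirashviliSereginSverak2009].
-/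

noncomputable section

open MeasureTheory Set Function Filter Topology Metric InnerProductSpace Real
open scoped RealInnerProductSpace Laplacian ContDiff Topology

-- the crux's namespace is already a prefix of the route's; silence the duplicate-namespace linter as the sibling files do
set_option linter.dupNamespace false

-- nested operator types `ℝ³ →L[ℝ] ℝ³ →L[ℝ] ℝ³ →L[ℝ] ℝ`
set_option maxSynthPendingDepth 3

namespace Summit.NavierStokesRegularity.NavierStokesRegularity.Theorems.CoriolisHead

namespace LocalEnergyRescue

open Literature.Analysis Literature.Analysis.FluidPDE

/-- **A non-constant affine function is far from `BMO₂`**: for `ℓ ≠ 0`, `ρ > 0` and ANY constant `d`,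
`‖ℓ‖² |B₁| ρ⁵ / 1024 ≤ ∫_{B(0,ρ)} (⟪ℓ,y⟫ + d)² dy` — on the quarter-ball `B(ρℓ/(2‖ℓ‖), ρ/4)` (if `d ≥ 0`) or `B(−ρℓ/(2‖ℓ‖), ρ/4)`
(if `d < 0`) the integrand is at least `(‖ℓ‖ρ/4)²`. [folklore] -/
theorem sq_oscillation_affine_ge {ℓ : EuclideanSpace ℝ (Fin 3)} (hℓ : ℓ ≠ 0) {ρ : ℝ} (hρ : 0 < ρ) (d : ℝ) :
    ‖ℓ‖ ^ 2 * (volume (ball (0 : EuclideanSpace ℝ (Fin 3)) 1)).toReal * ρ ^ 5 / 1024 ≤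
      ∫ y in ball (0 : EuclideanSpace ℝ (Fin 3)) ρ, (⟪ℓ, y⟫ + d) ^ 2 := by
  have hℓpos : 0 < ‖ℓ‖ := norm_pos_iff.2 hℓ
  -- the sign `σ = ±1` and the quarter-ball centre `y₁ = σ (ρ / (2‖ℓ‖)) ℓ`
  obtain ⟨σ, hσ, hσd⟩ : ∃ σ : ℝ, (σ = 1 ∨ σ = -1) ∧ 0 ≤ σ * d := by
    rcases le_or_gt 0 d with hd | hd
    · exact ⟨1, Or.inl rfl, by rw [one_mul]; exact hd⟩
    · exact ⟨-1, Or.inr rfl, by nlinarith⟩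
  have hσ2 : σ ^ 2 = 1 := by rcases hσ with h | h <;> rw [h] <;> norm_num
  have hσabs : |σ| = 1 := by rcases hσ with h | h <;> rw [h] <;> norm_num
  set y₁ : EuclideanSpace ℝ (Fin 3) := (σ * (ρ / (2 * ‖ℓ‖))) • ℓ with hy₁
  have hy₁norm : ‖y₁‖ = ρ / 2 := by
    rw [hy₁, norm_smul, Real.norm_eq_abs, abs_mul, hσabs, one_mul, abs_of_pos (by positivity)]
    field_simp
  have hinner₁ : ⟪ℓ, y₁⟫ = σ * (ρ * ‖ℓ‖ / 2) := by
    rw [hy₁, inner_smul_right, real_inner_self_eq_norm_sq]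
    field_simp
  -- the quarter-ball lies in `B(0, ρ)`
  have hsub : ball y₁ (ρ / 4) ⊆ ball (0 : EuclideanSpace ℝ (Fin 3)) ρ := by
    intro y hy
    rw [mem_ball, dist_eq_norm] at hy
    rw [mem_ball, dist_zero_right]
    calc ‖y‖ = ‖(y - y₁) + y₁‖ := by rw [sub_add_cancel]
      _ ≤ ‖y - y₁‖ + ‖y₁‖ := norm_add_le _ _
      _ < ρ / 4 + ρ / 2 := by rw [hy₁norm]; linarith
      _ ≤ ρ := by linarith
  -- on the quarter-ball, `σ (⟪ℓ,y⟫ + d) ≥ ‖ℓ‖ρ/4`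
  have hlow : ∀ y ∈ ball y₁ (ρ / 4), (‖ℓ‖ * ρ / 4) ^ 2 ≤ (⟪ℓ, y⟫ + d) ^ 2 := by
    intro y hy
    rw [mem_ball, dist_eq_norm] at hy
    have h1 : |⟪ℓ, y - y₁⟫| ≤ ‖ℓ‖ * (ρ / 4) :=
      (abs_real_inner_le_norm _ _).trans (mul_le_mul_of_nonneg_left hy.le (norm_nonneg _))
    have h2 : ⟪ℓ, y⟫ = ⟪ℓ, y - y₁⟫ + σ * (ρ * ‖ℓ‖ / 2) := by
      rw [← hinner₁, ← inner_add_right, sub_add_cancel]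
    have h3 : ‖ℓ‖ * ρ / 4 ≤ σ * (⟪ℓ, y⟫ + d) := by
      rw [h2]
      have h4 : σ * (⟪ℓ, y - y₁⟫ + σ * (ρ * ‖ℓ‖ / 2) + d) =
          σ * ⟪ℓ, y - y₁⟫ + σ ^ 2 * (ρ * ‖ℓ‖ / 2) + σ * d := by ring
      rw [h4, hσ2, one_mul]
      have h5 : -(‖ℓ‖ * (ρ / 4)) ≤ σ * ⟪ℓ, y - y₁⟫ := by
        have := abs_le.1 h1
        rcases hσ with h | h <;> rw [h] <;> linarith [this.1, this.2]
      linarith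
    have h0 : 0 ≤ ‖ℓ‖ * ρ / 4 := by positivity
    calc (‖ℓ‖ * ρ / 4) ^ 2 ≤ (σ * (⟪ℓ, y⟫ + d)) ^ 2 := pow_le_pow_left₀ h0 h3 2
      _ = (⟪ℓ, y⟫ + d) ^ 2 := by rw [mul_pow, hσ2, one_mul]
  -- integrate
  have hcont : Continuous fun y : EuclideanSpace ℝ (Fin 3) => (⟪ℓ, y⟫ + d) ^ 2 :=
    ((continuous_const.inner continuous_id).add continuous_const).pow 2
  have hi : IntegrableOn (fun y => (⟪ℓ, y⟫ + d) ^ 2) (ball (0 : EuclideanSpace ℝ (Fin 3)) ρ) volume :=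
    (hcont.continuousOn.integrableOn_compact (isCompact_closedBall _ _)).mono_set ball_subset_closedBall
  have hvol : volume.real (ball y₁ (ρ / 4)) = (ρ / 4) ^ 3 * (volume (ball (0 : EuclideanSpace ℝ (Fin 3)) 1)).toReal := by
    rw [measureReal_def, Measure.addHaar_ball volume y₁ (by positivity : (0:ℝ) ≤ ρ / 4), finrank_euclideanSpace_fin,
      ENNReal.toReal_mul, ENNReal.toReal_ofReal (by positivity)]
  calc ‖ℓ‖ ^ 2 * (volume (ball (0 : EuclideanSpace ℝ (Fin 3)) 1)).toReal * ρ ^ 5 / 1024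
      = (‖ℓ‖ * ρ / 4) ^ 2 * volume.real (ball y₁ (ρ / 4)) := by rw [hvol]; ring
    _ = ∫ y in ball y₁ (ρ / 4), (‖ℓ‖ * ρ / 4) ^ 2 := by rw [setIntegral_const, smul_eq_mul, mul_comm]
    _ ≤ ∫ y in ball y₁ (ρ / 4), (⟪ℓ, y⟫ + d) ^ 2 :=
        setIntegral_mono_on (integrableOn_const (measure_ball_lt_top.ne)) (hi.mono_set hsub) measurableSet_ball hlow
    _ ≤ ∫ y in ball (0 : EuclideanSpace ℝ (Fin 3)) ρ, (⟪ℓ, y⟫ + d) ^ 2 :=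
        setIntegral_mono_set hi (ae_of_all _ fun y => sq_nonneg _) hsub.eventuallyLE

section Profile

variable {ν a : ℝ} {B : EuclideanSpace ℝ (Fin 3) →L[ℝ] EuclideanSpace ℝ (Fin 3)}
  {U : EuclideanSpace ℝ (Fin 3) → EuclideanSpace ℝ (Fin 3)} {P : EuclideanSpace ℝ (Fin 3) → ℝ} {M : ℝ}

/-- **Identification of a `BMO₂` pressure with the Riesz pressure.**  If the pressure `P` of a bounded smooth rotated profile
(ANY `ν, a > 0`, skew `B`) has bounded quadratic mean oscillation on all balls, then `P = pressurePotentialMod 0 U + c`: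
`P − Q̃` is affine (`exists_affine_of_rieszPressure` with `N = Q̃`, smooth, `ΔQ̃ = ΔP`, `BMO₂`), and its linear part vanishes because
a non-constant affine function is not `BMO₂` (`sq_oscillation_affine_ge`).  This is the identification
«`P = RᵢRⱼ(UᵢUⱼ) + m`» used by stub S3a of the line. [cite: Seregin2014, §6.2 Thm 2.6, Remarks 6.2–6.4] -/
theorem pressure_eq_pressurePotentialMod_add_const (hν : 0 < ν) (ha : 0 < a)
    (hU : ContDiff ℝ (⊤ : ℕ∞) U) (hP : ContDiff ℝ 2 P) (hB : ∀ x, inner ℝ (B x) x = 0) (hdiv : VectorCalculus.IsDivFree U)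
    (heq : ∀ y, -(ν • (Δ U) y) + a • U y + a • fderiv ℝ U y y + (B (U y) - fderiv ℝ U y (B y)) +
      convect U U y + gradient P y = 0)
    (hM : ∀ y, ‖U y‖ ≤ M) {K : ℝ}
    (hK : ∀ (z : EuclideanSpace ℝ (Fin 3)) (ρ : ℝ), 0 < ρ → ∃ m : ℝ, ∫ y in ball z ρ, (P y - m) ^ 2 ≤ K * ρ ^ 3) :
    ∃ c : ℝ, ∀ y, P y = pressurePotentialMod 0 U y + c := by
  obtain ⟨κ, hκ0, hκ⟩ := exists_sq_oscillation_pressurePotentialMod_le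
  obtain ⟨hNs, hΔN⟩ := contDiff_pressurePotentialMod_of_rotatedProfile hU hP hdiv heq hM 0
  set N := pressurePotentialMod 0 U with hNdef
  have hKN : ∀ (z : EuclideanSpace ℝ (Fin 3)) (ρ : ℝ), 0 < ρ → ∃ m : ℝ, ∫ y in ball z ρ, (N y - m) ^ 2 ≤ κ * M ^ 4 * ρ ^ 3 :=
    fun z ρ hρ => hκ U M hU hM 0 z ρ hρ
  obtain ⟨ℓ, c, hPc⟩ := exists_affine_of_rieszPressure hν ha hU hP hB hdiv heq hM hNs hΔN hKN
  -- `K ≥ 0`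
  have hK0 : 0 ≤ K := by
    obtain ⟨m, hm⟩ := hK 0 1 one_pos
    have h0 : 0 ≤ ∫ y in ball (0 : EuclideanSpace ℝ (Fin 3)) 1, (P y - m) ^ 2 := integral_nonneg fun y => sq_nonneg _
    linarith
  have hM0 : 0 ≤ M := (norm_nonneg _).trans (hM 0)
  -- the affine part is `BMO₂` with constant `2(K + κM⁴)`
  set V : ℝ := (volume (ball (0 : EuclideanSpace ℝ (Fin 3)) 1)).toReal with hV
  have hVpos : 0 < V := by
    rw [hV]
    exact ENNReal.toReal_pos (measure_ball_pos volume _ one_pos).ne' measure_ball_lt_top.ne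
  have hPc' : ContDiff ℝ (⊤ : ℕ∞) P := contDiff_pressure_of_rotated hU (hP.of_le (by norm_cast)) heq
  have haff : ∀ ρ : ℝ, 0 < ρ → ∃ d : ℝ,
      ∫ y in ball (0 : EuclideanSpace ℝ (Fin 3)) ρ, (⟪ℓ, y⟫ + d) ^ 2 ≤ 2 * (K + κ * M ^ 4) * ρ ^ 3 := by
    intro ρ hρ
    obtain ⟨m₁, hm₁⟩ := hK 0 ρ hρ
    obtain ⟨m₂, hm₂⟩ := hKN 0 ρ hρ
    refine ⟨c - m₁ + m₂, ?_⟩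
    have hpt : ∀ y, (⟪ℓ, y⟫ + (c - m₁ + m₂)) ^ 2 ≤ 2 * (P y - m₁) ^ 2 + 2 * (N y - m₂) ^ 2 := by
      intro y
      have e : ⟪ℓ, y⟫ + (c - m₁ + m₂) = (P y - m₁) - (N y - m₂) := by rw [hPc y]; ring
      rw [e]
      nlinarith [sq_nonneg ((P y - m₁) + (N y - m₂))]
    have hcP : Continuous fun y => (P y - m₁) ^ 2 := (hPc'.continuous.sub continuous_const).pow 2
    have hcN : Continuous fun y => (N y - m₂) ^ 2 := (hNs.continuous.sub continuous_const).pow 2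
    have hiP : IntegrableOn (fun y => (P y - m₁) ^ 2) (ball (0 : EuclideanSpace ℝ (Fin 3)) ρ) volume :=
      (hcP.continuousOn.integrableOn_compact (isCompact_closedBall _ _)).mono_set ball_subset_closedBall
    have hiN : IntegrableOn (fun y => (N y - m₂) ^ 2) (ball (0 : EuclideanSpace ℝ (Fin 3)) ρ) volume :=
      (hcN.continuousOn.integrableOn_compact (isCompact_closedBall _ _)).mono_set ball_subset_closedBall
    have hcA : Continuous fun y : EuclideanSpace ℝ (Fin 3) => (⟪ℓ, y⟫ + (c - m₁ + m₂)) ^ 2 :=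
      ((continuous_const.inner continuous_id).add continuous_const).pow 2
    have hiA : IntegrableOn (fun y => (⟪ℓ, y⟫ + (c - m₁ + m₂)) ^ 2) (ball (0 : EuclideanSpace ℝ (Fin 3)) ρ) volume :=
      (hcA.continuousOn.integrableOn_compact (isCompact_closedBall _ _)).mono_set ball_subset_closedBall
    calc ∫ y in ball (0 : EuclideanSpace ℝ (Fin 3)) ρ, (⟪ℓ, y⟫ + (c - m₁ + m₂)) ^ 2
        ≤ ∫ y in ball (0 : EuclideanSpace ℝ (Fin 3)) ρ, (2 * (P y - m₁) ^ 2 + 2 * (N y - m₂) ^ 2) :=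
          setIntegral_mono_on hiA (show IntegrableOn (fun y => 2 * (P y - m₁) ^ 2 + 2 * (N y - m₂) ^ 2)
              (ball (0 : EuclideanSpace ℝ (Fin 3)) ρ) volume from (hiP.const_mul 2).add (hiN.const_mul 2))
            measurableSet_ball fun y _ => hpt y
      _ = 2 * (∫ y in ball (0 : EuclideanSpace ℝ (Fin 3)) ρ, (P y - m₁) ^ 2) +
            2 * ∫ y in ball (0 : EuclideanSpace ℝ (Fin 3)) ρ, (N y - m₂) ^ 2 := by
          rw [integral_add (hiP.const_mul 2) (hiN.const_mul 2), integral_const_mul, integral_const_mul]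
      _ ≤ 2 * (K * ρ ^ 3) + 2 * (κ * M ^ 4 * ρ ^ 3) := by nlinarith [hm₁, hm₂]
      _ = 2 * (K + κ * M ^ 4) * ρ ^ 3 := by ring
  -- hence `ℓ = 0`
  have hℓ : ℓ = 0 := by
    by_contra hℓ
    have hℓpos : 0 < ‖ℓ‖ := norm_pos_iff.2 hℓ
    -- a radius with `‖ℓ‖² V ρ² / 1024 > 2 (K + κ M⁴)`
    set ρ : ℝ := Real.sqrt (2048 * (K + κ * M ^ 4) / (‖ℓ‖ ^ 2 * V)) + 1 with hρdef
    have hρ : 0 < ρ := by positivity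
    have hρgt : Real.sqrt (2048 * (K + κ * M ^ 4) / (‖ℓ‖ ^ 2 * V)) < ρ := by rw [hρdef]; linarith
    have hρ2 : 2048 * (K + κ * M ^ 4) / (‖ℓ‖ ^ 2 * V) < ρ ^ 2 := by
      have h0 : 0 ≤ 2048 * (K + κ * M ^ 4) / (‖ℓ‖ ^ 2 * V) := by positivity
      calc 2048 * (K + κ * M ^ 4) / (‖ℓ‖ ^ 2 * V)
          = Real.sqrt (2048 * (K + κ * M ^ 4) / (‖ℓ‖ ^ 2 * V)) ^ 2 := (Real.sq_sqrt h0).symm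
        _ < ρ ^ 2 := pow_lt_pow_left₀ hρgt (Real.sqrt_nonneg _) two_ne_zero
    obtain ⟨d, hd⟩ := haff ρ hρ
    have hlow := sq_oscillation_affine_ge hℓ hρ d
    have h1 : ‖ℓ‖ ^ 2 * V * ρ ^ 5 / 1024 ≤ 2 * (K + κ * M ^ 4) * ρ ^ 3 := hlow.trans hd
    have h2 : 2048 * (K + κ * M ^ 4) < ρ ^ 2 * (‖ℓ‖ ^ 2 * V) := by
      rwa [div_lt_iff₀ (by positivity)] at hρ2
    nlinarith [pow_pos hρ 3, h1, h2]
  refine ⟨c, fun y => ?_⟩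
  rw [hPc y, hℓ, inner_zero_left, zero_add]

end Profile

end LocalEnergyRescue

end Summit.NavierStokesRegularity.NavierStokesRegularity.Theorems.CoriolisHead

end
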